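import Mathlib.Analysis.Analytic.ChangeOrigin
import Mathlib.Analysis.Analytic.IteratedFDeriv
import Literature.Analysis.ODE.SmoothDependence
import HarnessLib

/-!
# The Nemytskii operator of a real-analytic map is real-analytic

Topic `Analysis/ODE`. Towards **analytic dependence of solutions of analytic ordinary differential
equations on initial conditions** (the `C^ω` case of Lang, *Differential and Riemannian Manifolds*
(1995), Ch. IV §1, Thm. 1.14 / the classical Cauchy–Poincaré theorem), needed for the real-analytic
exponential map of a real-analytic Riemannian metric (programme towards
`Literature.Geometry.Riemannian.buchner1977_cutLocus_triangulable`, Buchner 1977: the cut locus of a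
compact real-analytic Riemannian manifold is subanalytic). The sibling file
`SmoothDependence.lean` proves Lang's theorem for `C^n`, `n ≤ ∞`, by the implicit function theorem
applied to the Robbin–Lang map `T((λ, x), σ) = x + λ ∫₀ f ∘ σ − σ` on `C([0,1], E)`; Mathlib's
implicit function theorem is available in class `C^ω` as well, so the only missing ingredient for
the analytic case is the analyticity of the **Nemytskii operator** `σ ↦ f ∘ σ` on `C(K, E)`, which
this file proves:

* `exists_uniform_hasFPowerSeriesOnBall_nhds`, `exists_uniform_hasFPowerSeriesOnBall_of_isCompact`
  — **uniform Cauchy estimates near a compact set**: if `g` is real-analytic at every point of a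
  compact set `L`, there are `ρ > 0` and `C ≥ 0` such that at every `y ∈ L` the function `g` has
  a power series expansion on the ball of radius `ρ` whose `n`-th coefficient `qₙ` satisfies
  `‖qₙ‖ ρⁿ ≤ C` (change of origin inside one expansion, `HasFPowerSeriesOnBall.changeOrigin`, with
  the summability estimate `FormalMultilinearSeries.changeOriginSeries_summable_aux₁` behind
  Mathlib's `FormalMultilinearSeries.changeOrigin_radius`; then a finite subcover);
* `norm_iteratedFDeriv_le_of_hasFPowerSeriesOnBall` — `‖Dⁿg(y)‖ ≤ n! ‖qₙ‖` for a power series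
  `q` of `g` at `y` (the symmetrisation formula
  `HasFPowerSeriesOnBall.iteratedFDeriv_eq_sum_of_completeSpace`);
* `exists_applyCMM` — pointwise application `C(K, E [×n]→L F) → (C(K, E)ⁿ → C(K, F))` as a
  continuous multilinear map (the multilinear sibling of `applyCLM` of `SmoothDependence.lean`;
  an existence statement, the file being definition-free);
* `hasFPowerSeriesOnBall_nemytskii`, `analyticAt_nemytskii`, `contDiffAt_nemytskii_omega` —
  **if `g : E → F` is real-analytic at every point of a set containing the range of
  `α : C(K, E)` (`K` compact, `F` complete), then `β ↦ g ∘ β : C(K, E) → C(K, F)` is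
  real-analytic at `α`**, with the expansion `(h₁, …, hₙ) ↦ (k ↦ (n!)⁻¹ Dⁿg(α k)(h₁ k, …, hₙ k))`
  on a ball of positive radius.

No named facts; everything is proved. [folklore] statements throughout (standard functional
analysis; cf. Appell–Zabrejko, *Nonlinear superposition operators* (1990), Ch. 6 for the
analyticity of superposition operators).

## References

* S. Lang, Differential and Riemannian Manifolds, GTM 160 (1995), Ch. IV §1. [Lang1995]
-/

noncomputable section

open Set Metric Filter Topology Function
open scoped ContDiff NNReal ENNReal Nat

namespace Literature.Analysis.ODE

/-! ### Uniform Cauchy estimates near a compact set -/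

section Uniform

variable {E F : Type*} [NormedAddCommGroup E] [NormedSpace ℝ E] [NormedAddCommGroup F]
  [NormedSpace ℝ F] [CompleteSpace F]

/-- A slice of a `ℝ≥0∞`-valued series over a sigma type is bounded by the whole series. [folklore] -/
theorem tsum_sigma_slice_le {β : ℕ → Type*} (G : (Σ k, β k) → ℝ≥0∞) (n : ℕ) :
    ∑' b : β n, G ⟨n, b⟩ ≤ ∑' σ, G σ := by
  rw [ENNReal.tsum_sigma' G]
  exact ENNReal.le_tsum n

/-- **Uniform power series expansions near a point of analyticity.** If `g` is analytic at `y₀`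
with expansion `p` on a ball of radius `r`, then for `r₁` with `2 r₁ < r` every `y` with
`‖y - y₀‖ < r₁` is the centre of the expansion `p.changeOrigin (y - y₀)` of `g`, valid on the ball
of radius `r₁`, with the UNIFORM coefficient bound `‖(p.changeOrigin (y - y₀)) n‖ r₁ⁿ ≤ T`,
`T = ∑ ‖p_{k+l}‖ (k+l choose l) r₁^{k+l}` (the estimate behind
`FormalMultilinearSeries.changeOrigin_radius`). [folklore] -/
theorem exists_uniform_hasFPowerSeriesOnBall_nhds {g : E → F} {y₀ : E} (hg : AnalyticAt ℝ g y₀) :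
    ∃ r₁ : ℝ≥0, 0 < r₁ ∧ ∃ T : ℝ≥0, ∀ y ∈ ball y₀ r₁,
      ∃ q : FormalMultilinearSeries ℝ E F, HasFPowerSeriesOnBall g q y r₁ ∧
        ∀ n, ‖q n‖₊ * r₁ ^ n ≤ T := by
  obtain ⟨p, r, hp⟩ := hg
  obtain ⟨r₂, h0r₂, hr₂r⟩ := ENNReal.lt_iff_exists_nnreal_btwn.1 hp.r_pos
  have h0r₂' : 0 < r₂ := by exact_mod_cast h0r₂
  set r₁ : ℝ≥0 := r₂ / 2 with hr₁
  have hr₁0 : 0 < r₁ := by positivity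
  have h2r₁ : r₁ + r₁ = r₂ := by rw [hr₁]; ring
  have hsumlt : ((r₁ + r₁ : ℝ≥0) : ℝ≥0∞) < p.radius := by
    rw [h2r₁]
    exact hr₂r.trans_le hp.r_le
  have hsum := p.changeOriginSeries_summable_aux₁ (r := r₁) (r' := r₁)
    (by exact_mod_cast hsumlt)
  set T : ℝ≥0 := ∑' s : Σ k l : ℕ, {s : Finset (Fin (k + l)) // s.card = l},
    ‖p (s.1 + s.2.1)‖₊ * r₁ ^ s.2.1 * r₁ ^ s.1 with hT
  refine ⟨r₁, hr₁0, T, fun y hy => ?_⟩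
  set x : E := y - y₀ with hx
  have hxr₁ : ‖x‖₊ < r₁ := by
    have h : dist y y₀ < r₁ := hy
    rw [dist_eq_norm] at h
    exact_mod_cast h
  have hr₁r : (r₁ : ℝ≥0∞) + r₁ < r := by
    have h : ((r₁ + r₁ : ℝ≥0) : ℝ≥0∞) < r := by rw [h2r₁]; exact hr₂r
    exact_mod_cast h
  have hxr : (‖x‖₊ : ℝ≥0∞) < r :=
    lt_trans (by exact_mod_cast hxr₁) (lt_of_le_of_lt le_self_add hr₁r)
  have hxrad : (‖x‖₊ : ℝ≥0∞) < p.radius := hxr.trans_le hp.r_le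
  have hr₁rad : (r₁ : ℝ≥0∞) < p.radius := (lt_of_le_of_lt le_self_add hr₁r).trans_le hp.r_le
  refine ⟨p.changeOrigin x, ?_, fun n => ?_⟩
  · -- the changed-origin expansion, valid on the ball of radius `r - ‖x‖ ≥ r₁`
    have h := hp.changeOrigin hxr
    have hyx : y₀ + x = y := by rw [hx]; abel
    rw [hyx] at h
    refine h.mono (by exact_mod_cast hr₁0) ?_
    -- `r₁ ≤ r - ‖x‖`
    refine ENNReal.le_sub_of_add_le_right ENNReal.coe_ne_top (le_of_lt (lt_of_le_of_lt ?_ hr₁r))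
    gcongr
  · -- the uniform coefficient bound, computed in `ℝ≥0∞`
    have h1 : (‖p.changeOrigin x n‖₊ : ℝ≥0∞) ≤
        ∑' s : Σ l : ℕ, {s : Finset (Fin (n + l)) // s.card = l},
          ((‖p (n + s.1)‖₊ * ‖x‖₊ ^ s.1 : ℝ≥0) : ℝ≥0∞) := by
      have h := ENNReal.coe_le_coe.2 (p.nnnorm_changeOrigin_le n hxrad)
      rwa [ENNReal.coe_tsum (p.changeOriginSeries_summable_aux₂ hxrad n)] at h
    have h2 : (∑' s : Σ l : ℕ, {s : Finset (Fin (n + l)) // s.card = l},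
          ((‖p (n + s.1)‖₊ * ‖x‖₊ ^ s.1 : ℝ≥0) : ℝ≥0∞)) ≤
        ∑' s : Σ l : ℕ, {s : Finset (Fin (n + l)) // s.card = l},
          ((‖p (n + s.1)‖₊ * r₁ ^ s.1 : ℝ≥0) : ℝ≥0∞) :=
      ENNReal.tsum_le_tsum fun s => by
        gcongr
    have h3 : (∑' s : Σ l : ℕ, {s : Finset (Fin (n + l)) // s.card = l},
          ((‖p (n + s.1)‖₊ * r₁ ^ s.1 : ℝ≥0) : ℝ≥0∞)) * (r₁ : ℝ≥0∞) ^ n ≤ T := by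
      have hslice := tsum_sigma_slice_le
        (fun σ : Σ k : ℕ, (Σ l : ℕ, {s : Finset (Fin (k + l)) // s.card = l}) =>
          ((‖p (σ.1 + σ.2.1)‖₊ * r₁ ^ σ.2.1 * r₁ ^ σ.1 : ℝ≥0) : ℝ≥0∞)) n
      rw [← ENNReal.tsum_mul_right, hT, ENNReal.coe_tsum hsum]
      refine le_trans (le_of_eq (tsum_congr fun s => ?_)) hslice
      push_cast
      ring
    have h5 : ((‖p.changeOrigin x n‖₊ * r₁ ^ n : ℝ≥0) : ℝ≥0∞) ≤ T := by
      push_cast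
      calc (‖p.changeOrigin x n‖₊ : ℝ≥0∞) * (r₁ : ℝ≥0∞) ^ n
          ≤ (∑' s : Σ l : ℕ, {s : Finset (Fin (n + l)) // s.card = l},
              ((‖p (n + s.1)‖₊ * ‖x‖₊ ^ s.1 : ℝ≥0) : ℝ≥0∞)) * (r₁ : ℝ≥0∞) ^ n := by gcongr
        _ ≤ (∑' s : Σ l : ℕ, {s : Finset (Fin (n + l)) // s.card = l},
              ((‖p (n + s.1)‖₊ * r₁ ^ s.1 : ℝ≥0) : ℝ≥0∞)) * (r₁ : ℝ≥0∞) ^ n := by gcongr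
        _ ≤ T := h3
    exact_mod_cast h5

/-- **Uniform Cauchy estimates near a compact set.** If `g` is real-analytic at every point of a
compact set `L` (`F` complete), there are `ρ > 0` and `C ≥ 0` such that at every `y ∈ L` the map
`g` has a power series expansion `q` on the ball of radius `ρ` with `‖q n‖ ρⁿ ≤ C` for all `n`
(finite subcover of `exists_uniform_hasFPowerSeriesOnBall_nhds`). [folklore] -/
theorem exists_uniform_hasFPowerSeriesOnBall_of_isCompact {g : E → F} {L : Set E}
    (hL : IsCompact L) (hg : ∀ y ∈ L, AnalyticAt ℝ g y) :
    ∃ ρ : ℝ≥0, 0 < ρ ∧ ∃ C : ℝ≥0, ∀ y ∈ L,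
      ∃ q : FormalMultilinearSeries ℝ E F, HasFPowerSeriesOnBall g q y ρ ∧
        ∀ n, ‖q n‖₊ * ρ ^ n ≤ C := by
  classical
  choose! r₁ hr₁ T hT using fun y (hy : y ∈ L) => exists_uniform_hasFPowerSeriesOnBall_nhds (hg y hy)
  obtain ⟨t, htL, hcover⟩ := hL.elim_nhds_subcover (fun y => ball y (r₁ y))
    fun y hy => ball_mem_nhds y (by exact_mod_cast hr₁ y hy)
  rcases t.eq_empty_or_nonempty with ht | ht
  · -- `L` is empty
    refine ⟨1, one_pos, 0, fun y hy => ?_⟩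
    have : y ∈ (⋃ x ∈ t, ball x (r₁ x : ℝ)) := hcover hy
    rw [ht] at this
    simp at this
  refine ⟨t.inf' ht r₁, (Finset.lt_inf'_iff ht).2 fun i hi => hr₁ i (htL i hi), t.sup T,
    fun y hy => ?_⟩
  obtain ⟨i, hi, hyi⟩ := mem_iUnion₂.1 (hcover hy)
  obtain ⟨q, hq, hqT⟩ := hT i (htL i hi) y hyi
  have hρi : t.inf' ht r₁ ≤ r₁ i := Finset.inf'_le _ hi
  refine ⟨q, hq.mono (by exact_mod_cast (Finset.lt_inf'_iff ht).2 fun j hj => hr₁ j (htL j hj))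
    (by exact_mod_cast hρi), fun n => ?_⟩
  calc ‖q n‖₊ * t.inf' ht r₁ ^ n ≤ ‖q n‖₊ * r₁ i ^ n := by gcongr
    _ ≤ T i := hqT n
    _ ≤ t.sup T := Finset.le_sup hi

/-- **Operator-norm Cauchy estimate for iterated derivatives**: if `g` has the power series `q` at
`y` then `‖Dⁿg(y)‖ ≤ n! ‖qₙ‖` — the iterated derivative is the symmetrisation
`v ↦ ∑_σ qₙ(v ∘ σ)` of the `n`-th coefficient
(`HasFPowerSeriesOnBall.iteratedFDeriv_eq_sum_of_completeSpace`). [folklore] -/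
theorem norm_iteratedFDeriv_le_of_hasFPowerSeriesOnBall {g : E → F}
    {q : FormalMultilinearSeries ℝ E F} {y : E} {r : ℝ≥0∞} (h : HasFPowerSeriesOnBall g q y r)
    (n : ℕ) : ‖iteratedFDeriv ℝ n g y‖ ≤ n ! * ‖q n‖ := by
  refine ContinuousMultilinearMap.opNorm_le_bound (by positivity) fun v => ?_
  rw [h.iteratedFDeriv_eq_sum_of_completeSpace]
  calc ‖∑ σ : Equiv.Perm (Fin n), q n (fun i => v (σ i))‖
      ≤ ∑ σ : Equiv.Perm (Fin n), ‖q n (fun i => v (σ i))‖ := norm_sum_le _ _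
    _ ≤ ∑ _σ : Equiv.Perm (Fin n), ‖q n‖ * ∏ i, ‖v i‖ := Finset.sum_le_sum fun σ _ => by
        calc ‖q n (fun i => v (σ i))‖ ≤ ‖q n‖ * ∏ i, ‖v (σ i)‖ := (q n).le_opNorm _
          _ = ‖q n‖ * ∏ i, ‖v i‖ := by rw [Equiv.prod_comp σ (fun i => ‖v i‖)]
    _ = n ! * ‖q n‖ * ∏ i, ‖v i‖ := by
        rw [Finset.sum_const, Finset.card_univ, Fintype.card_perm, Fintype.card_fin, nsmul_eq_mul]
        ring

end Uniform

/-! ### Pointwise application of multilinear-map-valued continuous maps -/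

section ApplyCMM

variable {K : Type*} [TopologicalSpace K] [CompactSpace K]
  {E F : Type*} [NormedAddCommGroup E] [NormedSpace ℝ E] [NormedAddCommGroup F] [NormedSpace ℝ F]

omit [CompactSpace K] [NormedSpace ℝ E] in
/-- Evaluating each component of a tuple of continuous maps at a point commutes with updating the
tuple (any `DecidableEq` instance on the index type, as in the fields of `MultilinearMap`).
[folklore] -/
theorem eval_update {n : ℕ} [DecidableEq (Fin n)] (h : Fin n → C(K, E)) (j : Fin n) (z : C(K, E))
    (k : K) :
    (fun i => Function.update h j z i k) = Function.update (fun i => h i k) j (z k) :=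
  funext (Function.apply_update (fun _ (c : C(K, E)) => c k) h j z)

/-- **Pointwise application of a continuous family of multilinear maps**: for
`A : C(K, E [×n]→L F)` the map `(h₁, …, hₙ) ↦ (k ↦ A k (h₁ k, …, hₙ k))` is a continuous
multilinear map `C(K, E)ⁿ → C(K, F)` of norm `≤ ‖A‖` (the multilinear analogue of `applyCLM`;
stated as an existence result to keep this file free of definitions). [folklore] -/
theorem exists_applyCMM {n : ℕ} (A : C(K, E [×n]→L[ℝ] F)) :
    ∃ P : ContinuousMultilinearMap ℝ (fun _ : Fin n => C(K, E)) C(K, F),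
      (∀ (h : Fin n → C(K, E)) (k : K), P h k = A k (fun i => h i k)) ∧ ‖P‖ ≤ ‖A‖ := by
  let P₀ : MultilinearMap ℝ (fun _ : Fin n => C(K, E)) C(K, F) :=
    { toFun := fun h => ⟨fun k => A k (fun i => h i k),
        continuous_eval.comp ((map_continuous A).prodMk
          (continuous_pi fun i => map_continuous (h i)))⟩
      map_update_add' := fun h j x y => by
        ext k
        simp only [ContinuousMap.coe_mk, ContinuousMap.add_apply]
        rw [eval_update, eval_update, eval_update]
        exact (A k).map_update_add _ j (x k) (y k)
      map_update_smul' := fun h j c x => by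
        ext k
        simp only [ContinuousMap.coe_mk, ContinuousMap.smul_apply]
        rw [eval_update, eval_update]
        exact (A k).map_update_smul _ j c (x k) }
  have hbound : ∀ h, ‖P₀ h‖ ≤ ‖A‖ * ∏ i, ‖h i‖ := fun h => by
    refine (ContinuousMap.norm_le _ (by positivity)).2 fun k => ?_
    calc ‖A k (fun i => h i k)‖ ≤ ‖A k‖ * ∏ i, ‖h i k‖ := (A k).le_opNorm _
      _ ≤ ‖A‖ * ∏ i, ‖h i‖ := by
          gcongr with i
          · exact A.norm_coe_le_norm k
          · exact (h i).norm_coe_le_norm k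
  exact ⟨P₀.mkContinuous ‖A‖ hbound, fun h k => rfl,
    MultilinearMap.mkContinuous_norm_le _ (norm_nonneg A) _⟩

end ApplyCMM

/-! ### Analyticity of the Nemytskii operator -/

section Analytic

variable {K : Type*} [TopologicalSpace K] [CompactSpace K]
  {E F : Type*} [NormedAddCommGroup E] [NormedSpace ℝ E] [NormedAddCommGroup F] [NormedSpace ℝ F]

/-- **The Nemytskii operator of a real-analytic map is real-analytic.** Let `K` be compact, `F`
complete, `g : E → F` real-analytic at every point of a set `U` containing the range of
`α : C(K, E)` (no openness needed). Then
`β ↦ g ∘ β` has at `α` the power series expansion `P`,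
`P n (h₁, …, hₙ) = (k ↦ (n!)⁻¹ Dⁿg(α k)(h₁ k, …, hₙ k))`, on a ball of positive radius: with `ρ, C`
from the uniform Cauchy estimates on the compact range of `α`
(`exists_uniform_hasFPowerSeriesOnBall_of_isCompact`) the coefficients satisfy `‖P n‖ ρⁿ ≤ C`
(`norm_iteratedFDeriv_le_of_hasFPowerSeriesOnBall`), so the series
has radius `≥ ρ`; for `‖h‖ < ρ` it converges in `C(K, F)` (geometric bound), and its sum is
`g ∘ (α + h)` because evaluation at each `k ∈ K` turns it into the Taylor series of `g` at `α k`
evaluated at `h k`. [folklore] -/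
theorem hasFPowerSeriesOnBall_nemytskii [CompleteSpace F] {g : E → F} {U : Set E}
    (hg : AnalyticOnNhd ℝ g U) (α : C(K, E)) (hα : range α ⊆ U) :
    ∃ (P : FormalMultilinearSeries ℝ C(K, E) C(K, F)) (ρ : ℝ≥0), 0 < ρ ∧
      (∀ (n : ℕ) (h : Fin n → C(K, E)) (k : K),
        P n h k = ((n ! : ℝ)⁻¹) • iteratedFDeriv ℝ n g (α k) (fun i => h i k)) ∧
      HasFPowerSeriesOnBall (nemytskii g) P α ρ := by
  have hLc : IsCompact (range α) := isCompact_range (map_continuous α)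
  obtain ⟨ρ, hρ, C, hq⟩ := exists_uniform_hasFPowerSeriesOnBall_of_isCompact hLc
    fun y hy => hg y (hα hy)
  choose! q hq hqC using hq
  -- continuity of the iterated derivatives along `α`
  have hDc : ∀ n, Continuous (iteratedFDeriv ℝ n g ∘ α) := fun n =>
    continuous_comp_of_range_subset (hg.iteratedFDeriv n).continuousOn α hα
  -- the candidate expansion: `P n = (n!)⁻¹ • (pointwise application of Dⁿg ∘ α)`
  choose P₀ hP₀ hP₀norm using
    fun n => exists_applyCMM (K := K) (nemytskii (iteratedFDeriv ℝ n g) α)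
  set P : FormalMultilinearSeries ℝ C(K, E) C(K, F) := fun n => ((n ! : ℝ)⁻¹) • P₀ n with hPdef
  have hPapply : ∀ (n : ℕ) (h : Fin n → C(K, E)) (k : K),
      P n h k = ((n ! : ℝ)⁻¹) • iteratedFDeriv ℝ n g (α k) (fun i => h i k) := by
    intro n h k
    simp only [hPdef, smul_apply, ContinuousMap.smul_apply, hP₀, nemytskii_apply (hDc n)]
  -- coefficient bound
  have hcoeff : ∀ n, ‖P n‖ * (ρ : ℝ) ^ n ≤ C := by
    intro n
    have h1 : ‖P n‖ ≤ ((n ! : ℝ)⁻¹) * ‖nemytskii (iteratedFDeriv ℝ n g) α‖ := by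
      simp only [hPdef]
      rw [norm_smul, Real.norm_of_nonneg (by positivity)]
      gcongr
      exact hP₀norm n
    have h2 : ‖nemytskii (iteratedFDeriv ℝ n g) α‖ ≤ n ! * (C : ℝ) / (ρ : ℝ) ^ n := by
      refine (ContinuousMap.norm_le _ (by positivity)).2 fun k => ?_
      rw [nemytskii_apply (hDc n)]
      have hk : α k ∈ range α := mem_range_self k
      calc ‖(iteratedFDeriv ℝ n g ∘ α) k‖ = ‖iteratedFDeriv ℝ n g (α k)‖ := rfl
        _ ≤ n ! * ‖q (α k) n‖ := norm_iteratedFDeriv_le_of_hasFPowerSeriesOnBall (hq _ hk) n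
        _ ≤ n ! * ((C : ℝ) / (ρ : ℝ) ^ n) := by
            gcongr
            rw [le_div_iff₀ (by positivity)]
            exact_mod_cast hqC _ hk n
        _ = n ! * (C : ℝ) / (ρ : ℝ) ^ n := by ring
    calc ‖P n‖ * (ρ : ℝ) ^ n
        ≤ ((n ! : ℝ)⁻¹ * (n ! * (C : ℝ) / (ρ : ℝ) ^ n)) * (ρ : ℝ) ^ n := by
          gcongr
          exact h1.trans (by gcongr)
      _ = C := by field_simp
  have hradius : (ρ : ℝ≥0∞) ≤ P.radius := P.le_radius_of_bound (C : ℝ) hcoeff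
  refine ⟨P, ρ, hρ, hPapply, { r_le := hradius, r_pos := by exact_mod_cast hρ, hasSum := ?_ }⟩
  intro h hh
  have hhρ : ‖h‖ < ρ := by
    have := hh
    rw [Metric.mem_eball, edist_zero_right, enorm_lt_coe] at this
    exact_mod_cast this
  -- the series converges in `C(K, F)` by the geometric bound
  have hbound : ∀ n, ‖P n (fun _ => h)‖ ≤ C * (‖h‖ / ρ) ^ n := by
    intro n
    calc ‖P n (fun _ => h)‖ ≤ ‖P n‖ * ∏ _i : Fin n, ‖h‖ := (P n).le_opNorm _
      _ = (‖P n‖ * (ρ : ℝ) ^ n) * (‖h‖ / ρ) ^ n := by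
          have hρne : (ρ : ℝ) ≠ 0 := ne_of_gt (by exact_mod_cast hρ)
          rw [Finset.prod_const, Finset.card_univ, Fintype.card_fin, div_pow, mul_assoc,
            ← mul_div_assoc, mul_div_cancel_left₀ _ (pow_ne_zero n hρne)]
      _ ≤ C * (‖h‖ / ρ) ^ n := by gcongr; exact hcoeff n
  have hgeo : ‖h‖ / ρ < 1 := (div_lt_one (by exact_mod_cast hρ)).2 hhρ
  have hsumm : Summable fun n => P n (fun _ => h) :=
    Summable.of_norm_bounded ((summable_geometric_of_lt_one (by positivity) hgeo).mul_left (C : ℝ))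
      hbound
  -- identify the sum pointwise
  have hcont : Continuous (g ∘ ⇑(α + h)) := by
    refine continuous_iff_continuousAt.2 fun k => ?_
    have hk : α k ∈ range α := mem_range_self k
    have hmem : (α + h) k ∈ Metric.eball (α k) ρ := by
      rw [ContinuousMap.add_apply, Metric.mem_eball, edist_eq_enorm_sub, add_sub_cancel_left,
        enorm_lt_coe]
      exact_mod_cast lt_of_le_of_lt (h.norm_coe_le_norm k) hhρ
    exact ((hq _ hk).continuousOn.continuousAt (Metric.isOpen_eball.mem_nhds hmem)).comp
      (map_continuous (α + h)).continuousAt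
  have hS : nemytskii g (α + h) = ∑' n, P n (fun _ => h) := by
    ext k
    -- evaluation at `k` of the sum is the Taylor series of `g` at `α k` evaluated at `h k`
    have hk : α k ∈ range α := mem_range_self k
    have hev : HasSum (fun n => P n (fun _ => h) k) ((∑' n, P n (fun _ => h)) k) :=
      (hsumm.hasSum.map (ContinuousMap.evalCLM ℝ k) (ContinuousMap.evalCLM ℝ k).continuous :)
    have hTaylor : HasSum (fun n => P n (fun _ => h) k) (g (α k + h k)) := by
      have hs := (hq _ hk).hasSum (y := h k) (by
        rw [Metric.mem_eball, edist_zero_right, enorm_lt_coe]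
        exact_mod_cast lt_of_le_of_lt (h.norm_coe_le_norm k) hhρ)
      refine hs.congr_fun fun n => ?_
      rw [hPapply]
      have hf := (hq _ hk).factorial_smul (h k) n
      rw [← hf, ← Nat.cast_smul_eq_nsmul ℝ, smul_smul, inv_mul_cancel₀ (by positivity), one_smul]
    rw [nemytskii_apply hcont]
    exact hTaylor.unique hev
  rw [hS]
  exact hsumm.hasSum

/-- **The Nemytskii operator of a real-analytic map is real-analytic** (`K` compact, `F` complete,
`g` analytic at every point of a set containing the range of `α`). [folklore] -/
theorem analyticAt_nemytskii [CompleteSpace F] {g : E → F} {U : Set E}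
    (hg : AnalyticOnNhd ℝ g U) (α : C(K, E)) (hα : range α ⊆ U) :
    AnalyticAt ℝ (nemytskii g) α := by
  obtain ⟨P, ρ, -, -, h⟩ := hasFPowerSeriesOnBall_nemytskii hg α hα
  exact h.analyticAt

/-- The Nemytskii operator of a real-analytic map is of class `C^ω` (Mathlib's `ContDiffAt ℝ ω`)
at every curve with range in the domain of analyticity — the analytic case of
`contDiffAt_nemytskii`. [folklore] -/
theorem contDiffAt_nemytskii_omega [CompleteSpace F] {g : E → F} {U : Set E}
    (hg : AnalyticOnNhd ℝ g U) (α : C(K, E)) (hα : range α ⊆ U) :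
    ContDiffAt ℝ ω (nemytskii g) α :=
  (analyticAt_nemytskii hg α hα).contDiffAt

end Analytic

end Literature.Analysis.ODE

end
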